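import Mathlib
import Literature.Analysis.FluidPDE.Tao2016AveragedNS.ShiftSetCascadeFlows
import Literature.Analysis.FluidPDE.Tao2016AveragedNS.ShiftSetCascadeFlux
import Summits.NavierStokesRegularity.NavierStokesRegularity.Theorems.TaoLadderRungTwoFlatCertificateGlueCheckerLandSOn
import Summits.NavierStokesRegularity.NavierStokesRegularity.Theorems.TaoLadderRungTwoFlatCertificateGlueJacobianVarVecOn
import HarnessLib

/-!
# Certificate glue on a shift set `𝕊`, XXXVIII-j: THE STEP CHECKER WITH BOTH VARIATIONAL PASSES THROUGH THE SPARSE JACOBIANS — `checkStepGJ2` = `checkStepGJ`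
  (glue XXXVIII-d) with the NVE column of glue XXVI-b computed by `varVecLevelsA` (glue XXXVIII-i) instead of `varJetLevelsA`; `stepCert_of_checksGJ2`,
  `stepCert_of_recGJ2`, `stepCert_of_checkStepGJ2`, and the ONE lemma the abstract chain of glue XXXVIII-g/h needs: `stepFacts_of_checkStepGJ2` (+ the locality
  lemmas `checkStepGJ2_congr` / `checkStepGJ2_congr_slim` for per-step files) (helper for items stmt-NavierStokesRegularity-22987 `FlatGapCertificatesV2`
  (crux K_A♭ of route TaoLadderRungTwoFlat) and stmt-24295 K_A₂(64); cell harvest/h2-tao-ladder, p1 g18; PERFORMANCE: ≈ −25 s of the ≈ 200 s per step at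
  n = 98, p = 16 — and the first step checker that plugs into `stub_rung_quarter_of_certificateE3S` with no chain files of its own)

HONEST FRAMING: Tao-type MODEL lattices (Tao 2016 §4/§6 vocabulary, shift-set parametrised); soundness of a checker — NO certificate instance exists in the
tree, nothing is certified here, no stub is closed, nothing here is a statement about the Navier–Stokes equations.
-/

-- the sub-problem namespace repeats the summit name by design (D-0017)
set_option linter.dupNamespace false

namespace Summit.NavierStokesRegularity.NavierStokesRegularity.Theorems

open Set Finset Literature.Analysis.FluidPDE Literature.Analysis.FluidPDE.TaoCascade
open Summit.NavierStokesRegularity.NavierStokesRegularity.Theorems.TaylorModelCert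
open Summit.NavierStokesRegularity.NavierStokesRegularity.Theorems.TaylorModelReadout

namespace CertificateGlueOn

variable {m : ℕ} {Kb Ka : ℤ}

/-! ### The step checker, both variational passes through the Jacobians -/

/-- **THE VECTOR-LAYOUT STEP CHECKER OVER A GENERIC COEFFICIENT-BOX TABLE IS SOUND** (glue XXVII-d `stepCert_of_checksVR` with `coefBoxOf prec αq ωq Sp Sm`
replaced by any `cB` with `CoefBoxOK` — e.g. the tabulated `coefLookup` of glue XXV-m). [cite: Zgliczynski2002C1Lohner, §3–4 (Lohner-type parallelepiped frames and the C¹/variational enclosure); cell certificate format, Lohner step, vector remainder] -/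
theorem stepCert_of_checksGJ2 (hKb : 0 ≤ Kb) (hKa : 1 ≤ Ka) {shifts : List (ℤ × ℤ × ℤ)} (hnd : shifts.Nodup)
    (h𝕊 : IsNearestNeighbourSet shifts.toFinset) {q : ℚ} (hq : 0 < 1 + (q : ℝ))
    {αq : Fin m → Fin m → Fin m → ℤ × ℤ × ℤ → ℚ} {ωq : Fin m → ℤ → ℚ} (hω : ∀ i k, 0 < ωq i k)
    {prec p kexp nexp : ℕ} {Sp Sm : IntervalD} (hSp : sqrtCheck prec (1 + q) Sp = true)
    (hSm : sqrtCheck prec (1 / (1 + q)) Sm = true) {cB : Fin m → ℤ → Fin m → Fin m → ℤ × ℤ × ℤ → IntervalD}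
    (hcoef : CoefBoxOK shifts (q : ℝ) (fun i₁ i₂ i μ => (αq i₁ i₂ i μ : ℝ)) Kb Ka (fun i k => (ωq i k : ℝ)) cB)
    {M : ℤ → ℝ} {t : ℕ → ℝ} {Node Hull : ℕ → (Fin m → ℤ → ℝ) → Prop} {j : ℕ}
    {xD x'D rD r'D ρD ED E1D loD hiD : Array Dyad} {C Cn T : Array (Array Dyad)} {bD mC ρs δD : Dyad}
    {K A A' Eb Et h : ℚ}
    (hb : 0 ≤ bD.toReal) (hmC : 0 ≤ mC.toReal) (hρs : 0 ≤ ρs.toReal) (hAA' : A < A') (ht : t (j + 1) - t j = (h : ℝ))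
    (hchkB : checkB m Kb Ka shifts (cB) bD = true)
    (h2 : checkAbsLe (m * winLen Kb Ka) xD mC = true)
    (h3 : checkRowsLe (m * winLen Kb Ka) C rD ρD = true)
    (hhull : checkHull (m * winLen Kb Ka) ρD ED ρs = true)
    (h6 : checkRowsLe (m * winLen Kb Ka) T rD r'D = true)
    (h8 : checkERecVR m Kb Ka shifts (cB) p (dyadToRat bD) (dyadToRat mC) (dyadToRat ρs) h
      (dPArr (m * winLen Kb Ka) prec (IntervalD.polyLevelsA (m * winLen Kb Ka) prec
        (IntervalD.jetLevelsA (m * winLen Kb Ka) (pqBoxA Kb Ka prec shifts (cB)) prec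
          (pointBoxA (m * winLen Kb Ka) xD) p) p (ofRatRel prec h)) x'D)
      (kappaArr prec (m * winLen Kb Ka) Cn T
        (vcolsJ Kb Ka prec shifts (cB) p
          (IntervalD.jetLevelsA (m * winLen Kb Ka) (pqBoxA Kb Ka prec shifts (cB)) prec
            (hullBoxA (m * winLen Kb Ka) xD ρD ED) p) (ofRatRel prec h) C) rD)
      (nveArr (m * winLen Kb Ka) (IntervalD.polyLevelsA (m * winLen Kb Ka) prec
        (varVecLevelsA (m * winLen Kb Ka) prec (jacLevelsA (pqJacA Kb Ka prec shifts (cB))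
          (IntervalD.jetLevelsA (m * winLen Kb Ka) (pqBoxA Kb Ka prec shifts (cB)) prec
            (hullBoxA (m * winLen Kb Ka) xD ρD ED) p) p) (symBoxA (m * winLen Kb Ka) ED) p) p (ofRatRel prec h)))
      E1D = true)
    (h9 : checkGuardV (dyadToRat bD) (dyadToRat mC) (dyadToRat ρs) h = true)
    (h13 : checkCoverV m Kb Ka shifts (cB) xD ρD ED loD hiD h A' = true)
    (h10 : checkLipT m Kb Ka shifts (cB) loD hiD K = true)
    (h11 : checkDefectT m Kb Ka prec shifts αq ωq Eb Et loD hiD Sp Sm δD = true)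
    (h12 : checkGronwallK K (dyadToRat δD) h A kexp nexp = true)
    (hN : ∀ y, Node j y → PInParaV Kb Ka (fun i k => (ωq i k : ℝ)) (dvec (n := m * winLen Kb Ka) xD)
      (dmat (n := m * winLen Kb Ka) C) (dvec (n := m * winLen Kb Ka) rD) (dvec (n := m * winLen Kb Ka) ED) y)
    (hH : ∀ u ∈ Icc 0 (h : ℝ), ∀ y q' : Fin m → ℤ → ℝ,
      ProdTube Kb Ka (fun i k => (ωq i k : ℝ)) (dvec (n := m * winLen Kb Ka) xD) (dvec (n := m * winLen Kb Ka) ρD)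
        (dvec (n := m * winLen Kb Ka) ED) (vOf Kb Ka shifts (cB) loD hiD) u q' →
      (∀ i k, -Kb ≤ k → k ≤ Ka → |y i k - q' i k| ≤ (A : ℝ) * (ωq i k : ℝ)) → Hull j y)
    (hN' : ∀ y, PInParaV Kb Ka (fun i k => (ωq i k : ℝ)) (dvec (n := m * winLen Kb Ka) x'D)
      (dmat (n := m * winLen Kb Ka) Cn) (dvec (n := m * winLen Kb Ka) r'D) (fun c => dvec (n := m * winLen Kb Ka) E1D c + (A : ℝ)) y →
      Node (j + 1) y) :
    StepCert shifts.toFinset (q : ℝ) (fun i₁ i₂ i μ => (αq i₁ i₂ i μ : ℝ)) Kb Ka (Eb : ℝ) (Et : ℝ) M t Node Hull j := by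
  have hω' : ∀ i k, (0 : ℝ) < (ωq i k : ℝ) := fun i k => by exact_mod_cast hω i k
  have hKK : 0 ≤ Ka + Kb + 1 := by omega
  have hX : (pointBoxA (m * winLen Kb Ka) xD).size = m * winLen Kb Ka := by simp [pointBoxA]
  have hx := mem_pointBoxA (m * winLen Kb Ka) xD
  have hhmem : IntervalD.mem (t (j + 1) - t j) (ofRatRel prec h) := by rw [ht]; exact mem_ofRatRel prec h
  have hg := guardV_of_check h9
  have hgr := gronwallK_of_check h12
  have hKδ := nonneg_of_checkGronwallK h12
  have hE := eRecVR_of_check h8 hKK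
  simp only [cast_dyadToRat] at hg hgr hKδ hE
  have hAA'r : (A : ℝ) < (A' : ℝ) := by exact_mod_cast hAA'
  have hA0 : (0 : ℝ) ≤ (A : ℝ) := (gronwallBound_nonneg_of_zero hKδ.2 hg.1).trans hgr
  have hA' : 0 < A' := by
    have : (0 : ℝ) < (A' : ℝ) := hA0.trans_lt hAA'r
    exact_mod_cast this
  refine stepCert_of_plohner_mvr (ω := fun i k => (ωq i k : ℝ)) (p := p) hKb hKa hq hω' hb hmC hρs hKδ.1 hKδ.2 hAA'r
    (by rw [ht]; exact hg.1) (by rw [ht]; exact hg.2) (hB_of_checkB hKb hKa hω' hq hnd hcoef hchkB)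
    (hBrow2_of_coefBox hKb hKa hω' hq hnd hcoef)
    (abs_le_of_checkAbsLe h2) (mulVec_le_of_checkRowsLe h3) (hull_le_of_checkHull hhull)
    (abs_TPoly_sub_le_dPArr hKb hKa hnd hcoef p hX hx hhmem x'D)
    (kappa_of_kappaArrJ hKb hKa hnd hcoef p xD ρD ED hhmem C Cn T rD)
    (abs_VPoly_le_nveArrJ hKb hKa hnd hcoef p xD ρD ED hhmem)
    (mulVec_le_of_checkRowsLe h6) (fun c => by rw [ht]; exact hE c)
    (pqcN_prod_bound hKb hKa hω' hq hnd hcoef loD hiD)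
    (fun c => vRowSum_nonneg hnd loD hiD _ _)
    (fun c => by rw [ht]; exact hG_of_checkCoverV hnd hA' h13 hKK c)
    (fun u hu q' y hq' hnear => inBox_of_checkCoverV hnd hω h13 (by rwa [ht] at hu) hq' hnear)
    (pfieldLip_of_checkLipT hKb hKa hω' hq hcoef h10)
    (pinputDefect_of_checkDefectT prec hnd h𝕊 hq hω hSp hSm h11) (by rw [ht]; exact hgr) hN
    (fun u hu y q' hq' hnear => hH u (by rwa [ht] at hu) y q' hq' hnear) hN'


/-- **`StepCert j` OF THE DEFINITIONAL MESH (VECTOR LAYOUT, GENERIC COEFFICIENT TABLE) FROM THE TESTS OF RECORD `j` AND THE HAND-OVER TO RECORD `j+1`.**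
[cite: Zgliczynski2002C1Lohner, §3–4 (Lohner-type parallelepiped frames and the C¹/variational enclosure); cell certificate format, chain checker, vector remainder] -/
theorem stepCert_of_recGJ2 (hKb : 0 ≤ Kb) (hKa : 1 ≤ Ka) {shifts : List (ℤ × ℤ × ℤ)} (hnd : shifts.Nodup)
    (h𝕊 : IsNearestNeighbourSet shifts.toFinset) {q : ℚ} (hq : 0 < 1 + (q : ℝ))
    {αq : Fin m → Fin m → Fin m → ℤ × ℤ × ℤ → ℚ} {ωq : Fin m → ℤ → ℚ} (hω : ∀ i k, 0 < ωq i k)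
    {prec p kexp nexp : ℕ} {Sp Sm : IntervalD} (hSp : sqrtCheck prec (1 + q) Sp = true)
    (hSm : sqrtCheck prec (1 / (1 + q)) Sm = true) {cB : Fin m → ℤ → Fin m → Fin m → ℤ × ℤ × ℤ → IntervalD}
    (hcoef : CoefBoxOK shifts (q : ℝ) (fun i₁ i₂ i μ => (αq i₁ i₂ i μ : ℝ)) Kb Ka (fun i k => (ωq i k : ℝ)) cB)
    {M : ℤ → ℝ} {t : ℕ → ℝ} {rec : ℕ → VRec} {j : ℕ}
    {bD : Dyad} {Eb Et : ℚ}
    (hb : 0 ≤ bD.toReal) (hmC : 0 ≤ (rec j).mC.toReal) (hρs : 0 ≤ (rec j).ρs.toReal)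
    (hAA' : (rec j).A < (rec j).A') (ht : t (j + 1) - t j = ((rec j).h : ℝ))
    (hnext : checkHandsOverV (m * winLen Kb Ka) (rec j) (rec (j + 1)) = true)
    (hchkB : checkB m Kb Ka shifts (cB) bD = true)
    (h2 : checkAbsLe (m * winLen Kb Ka) (rec j).x (rec j).mC = true)
    (h3 : checkRowsLe (m * winLen Kb Ka) (rec j).C (rec j).r (rec j).ρ = true)
    (hhull : checkHull (m * winLen Kb Ka) (rec j).ρ (rec j).E (rec j).ρs = true)
    (h6 : checkRowsLe (m * winLen Kb Ka) (rec j).T (rec j).r (rec j).r' = true)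
    (h8 : checkERecVR m Kb Ka shifts (cB) p (dyadToRat bD) (dyadToRat (rec j).mC) (dyadToRat (rec j).ρs) (rec j).h
      (dPArr (m * winLen Kb Ka) prec (IntervalD.polyLevelsA (m * winLen Kb Ka) prec
        (IntervalD.jetLevelsA (m * winLen Kb Ka) (pqBoxA Kb Ka prec shifts (cB)) prec
          (pointBoxA (m * winLen Kb Ka) (rec j).x) p) p (ofRatRel prec (rec j).h)) (rec j).x')
      (kappaArr prec (m * winLen Kb Ka) (rec j).Cn (rec j).T
        (vcolsJ Kb Ka prec shifts (cB) p
          (IntervalD.jetLevelsA (m * winLen Kb Ka) (pqBoxA Kb Ka prec shifts (cB)) prec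
            (hullBoxA (m * winLen Kb Ka) (rec j).x (rec j).ρ (rec j).E) p) (ofRatRel prec (rec j).h) (rec j).C) (rec j).r)
      (nveArr (m * winLen Kb Ka) (IntervalD.polyLevelsA (m * winLen Kb Ka) prec
        (varVecLevelsA (m * winLen Kb Ka) prec (jacLevelsA (pqJacA Kb Ka prec shifts (cB))
          (IntervalD.jetLevelsA (m * winLen Kb Ka) (pqBoxA Kb Ka prec shifts (cB)) prec
            (hullBoxA (m * winLen Kb Ka) (rec j).x (rec j).ρ (rec j).E) p) p) (symBoxA (m * winLen Kb Ka) (rec j).E) p) p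
          (ofRatRel prec (rec j).h)))
      (rec j).E1 = true)
    (h9 : checkGuardV (dyadToRat bD) (dyadToRat (rec j).mC) (dyadToRat (rec j).ρs) (rec j).h = true)
    (h13 : checkCoverV m Kb Ka shifts (cB) (rec j).x (rec j).ρ (rec j).E (rec j).lo (rec j).hi (rec j).h
      (rec j).A' = true)
    (h10 : checkLipT m Kb Ka shifts (cB) (rec j).lo (rec j).hi (rec j).K = true)
    (h11 : checkDefectT m Kb Ka prec shifts αq ωq Eb Et (rec j).lo (rec j).hi Sp Sm (rec j).δ = true)
    (h12 : checkGronwallK (rec j).K (dyadToRat (rec j).δ) (rec j).h (rec j).A kexp nexp = true) :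
    StepCert shifts.toFinset (q : ℝ) (fun i₁ i₂ i μ => (αq i₁ i₂ i μ : ℝ)) Kb Ka (Eb : ℝ) (Et : ℝ) M t
      (nodeOfV Kb Ka ωq rec) (hullOfG Kb Ka shifts cB ωq rec) j := by
  refine stepCert_of_checksGJ2 hKb hKa hnd h𝕊 hq hω hSp hSm hcoef hb hmC hρs hAA' ht hchkB h2 h3 hhull h6 h8 h9 h13 h10 h11 h12 (fun _ hy => hy)
    (fun u hu _ q' hq' hnear => ?_) (fun _ hy => node_of_checkHandsOverV hnext hy)
  exact ⟨u, hu, q', hq', hnear⟩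


/-! ### One Boolean test per step -/

/-- **ALL TESTS OF VECTOR-LAYOUT STEP `j` OVER THE TABLE `cB`, NVE THROUGH THE JACOBIANS** (signs, hand-over, C2, C3v, hull radii, C6v, C8vr, C9v, cover C13v, K-table, defect table, Grönwall) as
one Boolean. [folklore] -/
def checkStepGJ2 (m : ℕ) (Kb Ka : ℤ) (prec p kexp nexp : ℕ) (shifts : List (ℤ × ℤ × ℤ))
    (cB : Fin m → ℤ → Fin m → Fin m → ℤ × ℤ × ℤ → IntervalD)
    (αq : Fin m → Fin m → Fin m → ℤ × ℤ × ℤ → ℚ) (ωq : Fin m → ℤ → ℚ) (Sp Sm : IntervalD) (bD : Dyad) (Eb Et : ℚ)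
    (rec : ℕ → VRec) (j : ℕ) : Bool :=
  let n := m * winLen Kb Ka
  let s := rec j
  let hI := ofRatRel prec s.h
  let JX := IntervalD.jetLevelsA n (pqBoxA Kb Ka prec shifts cB) prec (pointBoxA n s.x) p
  let JH := IntervalD.jetLevelsA n (pqBoxA Kb Ka prec shifts cB) prec (hullBoxA n s.x s.ρ s.E) p
  Dyad.ble (Dyad.ofInt 0) s.mC && Dyad.ble (Dyad.ofInt 0) s.ρs && decide (s.A < s.A') && decide (0 < s.h) &&
  checkHandsOverV n s (rec (j + 1)) &&
  checkAbsLe n s.x s.mC && checkRowsLe n s.C s.r s.ρ && checkHull n s.ρ s.E s.ρs && checkRowsLe n s.T s.r s.r' &&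
  checkERecVR m Kb Ka shifts cB p (dyadToRat bD) (dyadToRat s.mC) (dyadToRat s.ρs) s.h
    (dPArr n prec (IntervalD.polyLevelsA n prec JX p hI) s.x')
    (kappaArr prec n s.Cn s.T (vcolsJ Kb Ka prec shifts cB p JH hI s.C) s.r)
    (nveArr n (IntervalD.polyLevelsA n prec (varVecLevelsA n prec (jacLevelsA (pqJacA Kb Ka prec shifts cB) JH p) (symBoxA n s.E) p) p hI))
    s.E1 &&
  checkGuardV (dyadToRat bD) (dyadToRat s.mC) (dyadToRat s.ρs) s.h &&
  checkCoverV m Kb Ka shifts cB s.x s.ρ s.E s.lo s.hi s.h s.A' &&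
  checkLipT m Kb Ka shifts cB s.lo s.hi s.K &&
  checkDefectT m Kb Ka prec shifts αq ωq Eb Et s.lo s.hi Sp Sm s.δ &&
  checkGronwallK s.K (dyadToRat s.δ) s.h s.A kexp nexp

/-- **`StepCert` OF STEP `j` FROM THE TWO BOOLEANS** `checkGlobalG` and `checkStepGJ2 … j` (plus `CoefBoxOK` of the table), on the mesh `tOfV rec`.
[cite: Zgliczynski2002C1Lohner, §3–4 (Lohner-type parallelepiped frames and the C¹/variational enclosure); cell certificate format, branch checker, vector remainder] -/
theorem stepCert_of_checkStepGJ2 (hKb : 0 ≤ Kb) (hKa : 1 ≤ Ka) {shifts : List (ℤ × ℤ × ℤ)} (hnd : shifts.Nodup)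
    (h𝕊 : IsNearestNeighbourSet shifts.toFinset) {q : ℚ} {cB : Fin m → ℤ → Fin m → Fin m → ℤ × ℤ × ℤ → IntervalD}
    {αq : Fin m → Fin m → Fin m → ℤ × ℤ × ℤ → ℚ} {ωq : Fin m → ℤ → ℚ} (hω : ∀ i k, 0 < ωq i k)
    (hcoef : CoefBoxOK shifts (q : ℝ) (fun i₁ i₂ i μ => (αq i₁ i₂ i μ : ℝ)) Kb Ka (fun i k => (ωq i k : ℝ)) cB)
    {prec p kexp nexp : ℕ} {Sp Sm : IntervalD} {bD : Dyad} {Eb Et : ℚ} {M : ℤ → ℝ} {rec : ℕ → VRec} {j : ℕ}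
    (hg : checkGlobalG m Kb Ka prec shifts cB q Sp Sm bD = true)
    (hs : checkStepGJ2 m Kb Ka prec p kexp nexp shifts cB αq ωq Sp Sm bD Eb Et rec j = true) :
    StepCert shifts.toFinset (q : ℝ) (fun i₁ i₂ i μ => (αq i₁ i₂ i μ : ℝ)) Kb Ka (Eb : ℝ) (Et : ℝ) M (tOfV rec)
      (nodeOfV Kb Ka ωq rec) (hullOfG Kb Ka shifts cB ωq rec) j := by
  simp only [checkGlobalG, Bool.and_eq_true, decide_eq_true_eq, Dyad.ble_iff, Dyad.toReal_ofInt, Int.cast_zero] at hg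
  obtain ⟨⟨⟨⟨hSp, hSm⟩, hq⟩, hb⟩, hchkB⟩ := hg
  simp only [checkStepGJ2, Bool.and_eq_true, decide_eq_true_eq, Dyad.ble_iff, Dyad.toReal_ofInt, Int.cast_zero] at hs
  obtain ⟨⟨⟨⟨⟨⟨⟨⟨⟨⟨⟨⟨⟨⟨hmC, hρs⟩, hAA'⟩, hh⟩, hho⟩, h2⟩, h3⟩, hhull⟩, h6⟩, h8⟩, h9⟩, h13⟩, h10⟩, h11⟩, h12⟩ := hs
  have hq' : 0 < 1 + (q : ℝ) := by
    have : ((-1 : ℚ) : ℝ) < (q : ℝ) := by exact_mod_cast hq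
    push_cast at this; linarith
  exact stepCert_of_recGJ2 hKb hKa hnd h𝕊 hq' hω hSp hSm hcoef hb hmC hρs hAA' (tOfV_succ_sub rec j) hho hchkB h2 h3 hhull h6 h8 h9 h13 h10
    h11 h12

/-! ### The step facts and the locality lemmas -/

/-- **`checkStepGJ2` delivers the step facts** — the only input the chain of glue XXXVIII-g/h needs. [folklore] -/
theorem stepFacts_of_checkStepGJ2 (hKb : 0 ≤ Kb) (hKa : 1 ≤ Ka) {shifts : List (ℤ × ℤ × ℤ)} (hnd : shifts.Nodup)
    (h𝕊 : IsNearestNeighbourSet shifts.toFinset) {q : ℚ} {cB : Fin m → ℤ → Fin m → Fin m → ℤ × ℤ × ℤ → IntervalD}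
    {αq : Fin m → Fin m → Fin m → ℤ × ℤ × ℤ → ℚ} {ωq : Fin m → ℤ → ℚ} (hω : ∀ i k, 0 < ωq i k)
    (hcoef : CoefBoxOK shifts (q : ℝ) (fun i₁ i₂ i μ => (αq i₁ i₂ i μ : ℝ)) Kb Ka (fun i k => (ωq i k : ℝ)) cB)
    {prec p kexp nexp : ℕ} {Sp Sm : IntervalD} {bD : Dyad} {Eb Et : ℚ} {M : ℤ → ℝ} {rec : ℕ → VRec} {j : ℕ}
    (hg : checkGlobalG m Kb Ka prec shifts cB q Sp Sm bD = true)
    (hs : checkStepGJ2 m Kb Ka prec p kexp nexp shifts cB αq ωq Sp Sm bD Eb Et rec j = true) :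
    StepFacts shifts q αq Kb Ka prec cB ωq Sp Sm Eb Et M rec j := by
  have h := hs
  simp only [checkStepGJ2, Bool.and_eq_true, decide_eq_true_eq, Dyad.ble_iff, Dyad.toReal_ofInt, Int.cast_zero] at h
  obtain ⟨⟨⟨⟨⟨⟨⟨⟨⟨⟨⟨⟨⟨⟨-, -⟩, hAA'⟩, hh⟩, -⟩, -⟩, -⟩, -⟩, -⟩, -⟩, -⟩, h13⟩, -⟩, h11⟩, -⟩ := h
  exact ⟨stepCert_of_checkStepGJ2 hKb hKa hnd h𝕊 hω hcoef hg hs, hh, hAA', h13, h11⟩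

/-- **Locality of the step test**: `checkStepGJ2 … rec j` depends on `rec` only through `rec j` and `rec (j+1)`. [folklore] -/
theorem checkStepGJ2_congr {prec p kexp nexp : ℕ} {shifts : List (ℤ × ℤ × ℤ)}
    {cB : Fin m → ℤ → Fin m → Fin m → ℤ × ℤ × ℤ → IntervalD} {αq : Fin m → Fin m → Fin m → ℤ × ℤ × ℤ → ℚ} {ωq : Fin m → ℤ → ℚ}
    {Sp Sm : IntervalD} {bD : Dyad} {Eb Et : ℚ} {rec rec' : ℕ → VRec} {j : ℕ} (hj : rec j = rec' j) (hj1 : rec (j + 1) = rec' (j + 1)) :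
    checkStepGJ2 m Kb Ka prec p kexp nexp shifts cB αq ωq Sp Sm bD Eb Et rec j =
      checkStepGJ2 m Kb Ka prec p kexp nexp shifts cB αq ωq Sp Sm bD Eb Et rec' j := by
  simp only [checkStepGJ2, hj, hj1]

/-- **Finer locality**: record `j+1` enters only through its start data `x`, `C`, `r`, `E` (slim successor records in per-step files). [folklore] -/
theorem checkStepGJ2_congr_slim {prec p kexp nexp : ℕ} {shifts : List (ℤ × ℤ × ℤ)}
    {cB : Fin m → ℤ → Fin m → Fin m → ℤ × ℤ × ℤ → IntervalD} {αq : Fin m → Fin m → Fin m → ℤ × ℤ × ℤ → ℚ} {ωq : Fin m → ℤ → ℚ}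
    {Sp Sm : IntervalD} {bD : Dyad} {Eb Et : ℚ} {rec rec' : ℕ → VRec} {j : ℕ} (hj : rec j = rec' j) (hx : (rec (j + 1)).x = (rec' (j + 1)).x)
    (hC : (rec (j + 1)).C = (rec' (j + 1)).C) (hr : (rec (j + 1)).r = (rec' (j + 1)).r) (hE : (rec (j + 1)).E = (rec' (j + 1)).E) :
    checkStepGJ2 m Kb Ka prec p kexp nexp shifts cB αq ωq Sp Sm bD Eb Et rec j =
      checkStepGJ2 m Kb Ka prec p kexp nexp shifts cB αq ωq Sp Sm bD Eb Et rec' j := by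
  simp only [checkStepGJ2, checkHandsOverV, hj, hx, hC, hr, hE]

end CertificateGlueOn

end Summit.NavierStokesRegularity.NavierStokesRegularity.Theorems
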